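import Literature.MathematicalPhysics.QuantumFieldTheory.Balaban1983to89.B12Def267Covariance
import Literature.MathematicalPhysics.QuantumFieldTheory.Balaban1983to89.B12Average012Permutation

/-!
# `Balaban1983to89.B12Def267Permutation` — [Balaban1987RG1] (2.17) p. 269 for the AXIS PERMUTATIONS `r = r_σ` and
the p. 267 letters of the linearizing change of variables: «all the remaining operations preserve the invariance
for the same reasons as for the gauge invariance» — `Q̃_{rV}(rB′) = r Q̃_V(B′)`, `LQ̃_{rV}(rB′) = r LQ̃_V(B′)`,
`h_{rV}(rB) = r(h_V B)` («h is uniquely defined by these conditions»), `C̃_{rV}(rB′) = r C̃_V(B′)`,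
`D̃_{rV}(rB) = r D̃_V(B)` («exactly one solution») on the `ℤᵈ` carrier of the b12 lineage — PROVED

statement-level skeleton of published theorems with citation tags; proofs where landed; nothing here is a claim about the Yang–Mills mass gap

CITATION HEADER.  T. Bałaban, *Renormalization group approach to lattice gauge field theories. I. Generation of
effective actions in a small field approximation and a coupling constant renormalization in four dimensions*,
Commun. Math. Phys. **109** (1987) 249–301, doi:10.1007/bf01215223 [Balaban1987RG1] (cell paper B12; held text
`paper:balaban1987-cmp109-rg-i-small-field`, journal page = PDF page + 248; p. 267 [PDF 19] and p. 269 [PDF 21] re-read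
from the text layer `p0019.txt` / `p0021.txt` for this file, (0.7) p. 253 [PDF 5]).  Unit `lit-balaban-r09` gen 48
(display owner of CMP 109; TAKING line `HOME/STATUS.md` 2026-08-24T15:27:28Z), HOME `run/shared/lean/pub/lit-balaban/`;
SKELETON rows `B12.Eq2.17-2.18` (the permutation clause), `B12.Def@267` (the letters `h`, `C̃`, `D̃`), `B12.Eq2.4` (`Q̃`)
(cells only; no head change).  Companion files of the same letters: `B12Def267Covariance` (gauge transformations
(2.16), same seat gen 45), `B12JacobianGauge269` § 11 (lattice translations, unit `lit-balaban-r20`),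
`B12Average012Permutation` (the averages (0.11)/(0.12) under `r_σ`, same seat gen 12).

WHAT IS PRINTED (verbatim, «…»).
* p. 269 [PDF 21]: *«Now consider a Euclidean symmetry r of the torus T, preserving the torus T⁽ᵏ⁺¹⁾. We define
  generally (rU)(b) = U(rb), rb = r⟨b₋, b₊⟩ = ⟨rb₋, rb₊⟩. (2.17) By their definitions the expressions in (2.1) are
  invariant with respect to these transformations. If we split the field V = V′V⁽ᵏ⁾, and V⁽ᵏ⁾, U_{k+1} transform as
  above, then the expressions are still invariant assuming that V′ transforms as follows: (rV′)(b) = V′(rb) if rb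
  is positively oriented, (rV′)(b) = R(V⁽ᵏ⁾(rb))V′⁻¹(−(rb)) if rb is negatively oriented. (2.18) […] The
  transformation (2.18) generates an orthogonal transformation of the fluctuation field B′, hence all the remaining
  operations preserve the invariance for the same reasons as for the gauge invariance. Thus the effective action is
  invariant with respect to the Euclidean transformations (2.17) of the background field.»*  For an AXIS
  PERMUTATION `r = r_σ` every `rb` is positively oriented, so (2.18) reads `(rV′)(b) = V′(rb)`, i.e. `B′ ↦ rB′` with
  the SAME pull-back as (2.17) (no `R(·)` factor): here `r_σ` acts on bond fields of every level by
  `B12Average012Permutation.permE σ`.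
* p. 267 [PDF 19] (the «remaining operations»): *«At first we introduce an operator h. […] The function hB is equal
  to 0 everywhere, except the set {b₀(c) : c ∈ T⁽ᵏ⁺¹⁾}. […] Furthermore, the operator h satisfies the identity LQ̃h = I
  on T⁽ᵏ⁺¹⁾. Of course h is uniquely defined by these conditions […] We are looking for an analytic, 𝐠-valued
  function D̃(B′) […] such that the transformation B′ = B − hD̃(B) linearizes the function Q̃(B′). The function D̃(B)
  is determined by the equation LQ̃B′ + C̃(B′) = LQ̃B − D̃(B) + C̃(B − hD̃(B)) = LQ̃B. It is easy to prove […] that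
  there exists exactly one solution of this equation»*.
* p. 253 [PDF 5], (0.7): *«M(π{𝐔_j}) = M({𝐔_j}) for an arbitrary permutation π of the set {𝐔_j}»*.

DICTIONARY print → Lean (all PRE-EXISTING, consumed by name; nothing restated).  `r_σ x` ↦
`B12Average012Permutation.permSite σ x`; `(rU)(b) = U(rb)` ↦ `B12Average012Permutation.permE σ U` (bond fields of any
value type and any level; the coarse bond `c` goes to `(r_σ c₋, σμ)`); the averages (0.11)/(0.12) ↦
`B12ContourAverage253.Tavg` / `B12SmallFieldRegion255.avgBar` with their permutation covariance ON REGULAR `U1`-VALUED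
CONFIGURATIONS ↦ `B12Average012Permutation.Tavg_permE` / `avgBar_permE`; `V′V = e^{iB′}V` ↦ `B12AverageCorridor267.pert`;
`Q̃_V(B′)(c)` ↦ `B12AverageCorridor267.Qtilde L 𝐔 V B′ c` (𝐔 = `Tavg`), `LQ̃` ↦ `B12AverageCorridor267.LQ`; `h(c)` ↦
`B12ContourAverage253.hAverage`, `h` ↦ `B13PkLocalTerms.hOp (b0Z L) h(·)`, «0 everywhere except {b₀(c)}» ↦
`B12HOperator267.CorridorSupported`, the `h`-paragraph ↦ `B12ContourAverage253.h_paragraph_p267_average`; the `ℓ^∞`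
letters `BField`, `hfield`, `Cfield` and the existence/uniqueness package of `D̃` ↦ `B12LinearizationGenuineZd`;
Federbush's mean (0.10) by a base point ↦ `B12ContourAverage253.fedAvg` over `FederbushMean.fedSol`.

THE ARGUMENT FORMALISED.  The ONE point where the permutation case differs from the gauge case (2.16)
(`B12Def267Covariance`) and the translation case (`B12Average012QtildeCovariance.Qtilde_shiftE`, exact): the lineage's
mean (0.10) of the `d!` contour transporters `{U(Γ^π_{q,x})}_π` is BASED at the tree contour `π = 1` and extended
TOTALLY (by the base element) off the domain `‖U(Γ^π)U(Γ^1)⁻¹ − 1‖ ≤ 1/100`; the relabelling `r_σ` carries the family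
onto the family at `r_σ x` RE-INDEXED by `π ↦ σπ` (`family_permE`), i.e. it moves the base contour, and the mean is
unchanged only by (0.7) — base-point independence — which the tree proves (`fedAvg_base_indep`, `Tavg_eq_fedAvg`,
`Tavg_permE`) for `U1`-VALUED families.  The perturbed configuration `V′V = e^{iB′}V` of (2.4) is NOT `U1`-valued for
complex `B′`.  § 1 proves (0.7) WITHOUT unitarity: a family of units of PAIRWISE relative diameter `≤ 1/100` has a
base-point independent mean (`fedAvg_base_indep_of_pairwise`: with `g = F_{j₀}F_{j₁}⁻¹`, `g⁻¹X(j₀)` solves (0.10) at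
`j₁` inside the uniqueness ball of `FederbushMean.fedSol_unique`, `‖g⁻¹ − 1‖` being itself a member of the relative
family); § 2 deduces the covariance of (0.11), of the (0.12) loops and of the average (0.12) at ONE coarse bond under
the pairwise hypothesis at the finitely many sites involved (`Tavg_permE_of_pairwise`, `avgBar_permE_of_pairwise`);
§ 3 supplies the hypothesis for `V′V`: the transporters move by `Θ = (1 + ρ)^{dL} − 1` (`B12LQLocalityBound267.
norm_permT_sub_le`), the relative family by `3Θ`, so the pairwise diameter is `≤ 2(dL)²ε₀ + 3Θ`
(`norm_rel_pair_pert_sub_one_le`) — `≤ 1/100` on the ball `sup‖B′‖·dL ≤ 1/1200` when `(dL)²ε₀ ≤ 1/400`, and, along a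
line `s ↦ sB′` (any `B′`), for all small `s` by continuity when `(dL)²ε₀ < 1/200` (the transporters are analytic in
`s`, `B12Average012Analytic.analyticAt_permT`).  § 4: `Q̃_{r_σV}(r_σB′)(c) = Q̃_V(B′)(r_σc)` on the ball
(`Qtilde_permE_of_ball`) and eventually along lines (`Qtilde_permE_eventually`), whence `LQ̃` — the derivative at
`s = 0` — is covariant for EVERY `B′` (`LQ_permE`, `Filter.EventuallyEq.deriv_eq`).  § 5: print's «Of course h is
uniquely defined by these conditions» — `r_σ⁻¹ ∘ h_{r_σV} ∘ r_σ` is corridor-supported (`{b₀(c)}` is `r_σ`-stable,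
`permBond_b0Z`) and a right inverse of `LQ̃_V` (covariance of `LQ̃` at `(r_σV, σ⁻¹)`), hence equals `h_V`
(`hOp_hAverage_permE`; fibre form `h_{r_σV}(c) = h_V(r_σc)`, `hAverage_permE_apply`).  § 6: `C̃ = Q̃ − LQ̃` on the
ball (`Ctilde_permE`).  § 7: `r_σ` as a LINEAR ISOMETRY of `ℓ^∞` WITH BODY (`permBF`, `permBFEquiv`), and the `ℓ^∞`
letters of `B12LinearizationGenuineZd`: `hfield_permE`, `Cfield_permE`, `Dtilde_permE` (the rotated solution solves
the rotated fixed-point equation; uniqueness at `r_σV`).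

WHAT THIS MODULE PROVES (kernel-checked; no `sorry`; no `Prop` fact; definitions WITH BODY: `permBF`, `permBFEquiv`;
axioms standard): see the section list above; headline theorems **`fedAvg_base_indep_of_pairwise`**,
**`Tavg_permE_of_pairwise`**, **`avgBar_permE_of_pairwise`**, **`Qtilde_permE_of_ball`**, **`LQ_permE`**,
**`hOp_hAverage_permE`**, **`Ctilde_permE`**, **`hfield_permE`**, **`Cfield_permE`**, **`Dtilde_permE`**.

HONEST SCOPE / NOT PROVED HERE.  (a) AXIS PERMUTATIONS ONLY among print's «Euclidean symmetry r of the torus T,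
preserving the torus T⁽ᵏ⁺¹⁾»: the reflections are not symmetries of the lineage's corner-based contour family
(`B12Average012Permutation` DIVERGENCE (a)); translations: `B12Average012QtildeCovariance` / `B12JacobianGauge269` § 11;
gauge transformations (2.16): `B12Def267Covariance`.  (b) `ℤᵈ` corner cubes and the lineage's (0.10)–(0.12)
(`B12ContourAverage253` (a)–(c)); the torus statement (descent to the `LN`-periodic sub-carrier `perBF` of
`B12JacobianGauge269` § 10) is not written here.  (c) THRESHOLDS (print: ε₀ «sufficiently small»): the lineage's total
extension of (0.10) is NOT permutation symmetric off its domain, so a smallness condition is GENUINE, not cosmetic —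
`(dL)²ε₀ < 1/200` for `LQ̃` and `h` (§§ 4–5), `(dL)²ε₀ ≤ 1/400` with `sup‖B′‖·dL ≤ 1/1200` for `Q̃`, `C̃`, `D̃` at finite
`B′` (§§ 4, 6, 7); `U1`-valued `ε₀`-regular `V`, `d ≥ 1`, complete normed `ℂ`-algebra `𝔸` with `‖1‖ = 1`.
(d) Nothing of (2.18) proper (negatively oriented `rb`) is needed or claimed; nothing of the series.
-/

noncomputable section

open NormedSpace Finset Filter

namespace Literature.MathematicalPhysics.QuantumFieldTheory.Balaban1983to89.B12Def267Permutation

open _root_.Topology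
open Literature.MathematicalPhysics.QuantumLattice (ZdEdge blockBase blockMap blockSites mem_blockSites_iff
  plaquetteHolonomyZd)
open B7Prop1Explicit (U1 mem_U1)
open FederbushMean (fedSol fed fed_def fed_fedSol fedSol_unique norm_fedSol_sub_one_le)
open B12ContourAverage253 (rel fedUnit val_fedUnit fedAvg fedAvg_comp_equiv permT permT_mem_U1 Tavg
  rel_permT_small omegaA hAverage h_paragraph_p267_average)
open B12AverageCorridor267 (Ustr loopW loopW_def avgM pert pert_zero Qtilde LQ)
open B12SmallFieldRegion255 (avgBar)
open B12Average012Permutation (permSite permSite_add permSite_single permSite_blockBase permSite_inv_permSite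
  permSite_permSite_inv permE permE_apply permE_one permE_mul family_permE lineR_permE Ustr_permE
  sum_blockSites_permSite permE_mem_U1 permE_regular rel_permT_pair_small)
open B12LQLocalityBound267 (norm_permT_sub_le norm_pert_smul_sub_le)
open B12Average012Analytic (analyticAt_units_inv analyticAt_permT analyticAt_pert)
open B12HOperator267 (CorridorSupported)
open B13PkLocalTerms (hOp hOp_apply_b₀ hOp_eq_zero_off_range)
open B13CorridorSeparation (b0Z b0Z_injective)

variable {d : ℕ}
variable {𝔸 : Type*} [NormedRing 𝔸] [NormedAlgebra ℂ 𝔸] [NormOneClass 𝔸] [CompleteSpace 𝔸] {L : ℕ}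

/-! ## § 1  (0.7) without unitarity: Federbush's mean of a family of PAIRWISE small relative diameter does not
depend on the base point -/

section Mean

variable {ι : Type*} [Fintype ι] [Nonempty ι]

omit [NormOneClass 𝔸] in
/-- **(0.7) PROPER, `U1`-FREE — INDEPENDENCE OF THE BASE POINT** («M(π{𝐔_j}) = M({𝐔_j}) for an arbitrary permutation
π of the set {𝐔_j}»): for a family `F` of units of a complete normed algebra with PAIRWISE relative diameter
`‖F_i F_k⁻¹ − 1‖ ≤ δ ≤ 1/100` (no bound on `‖F_j‖` is assumed), the lineage's mean based at `j₀` equals the mean based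
at `j₁`: with `g = F_{j₀}F_{j₁}⁻¹` the element `g⁻¹ X`, `X = fedSol (F_j F_{j₀}⁻¹)_j`, solves (0.10) for the family
seen from `j₁` and lies in the uniqueness ball of `FederbushMean.fedSol_unique` (`‖g⁻¹ − 1‖ ≤ δ` because `g⁻¹` is a
member of the relative family, `‖X − 1‖ ≤ 3δ`).  The tree's `B12ContourAverage253.fedAvg_base_indep` is the same
statement for `U1`-valued families. [cite: Balaban1987RG1, (0.7) p.253] -/
theorem fedAvg_base_indep_of_pairwise {δ : ℝ} (hδ : δ ≤ 1 / 100) {F : ι → 𝔸ˣ}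
    (h : ∀ i k, ‖rel F k i - 1‖ ≤ δ) (j₀ j₁ : ι) : fedAvg F j₀ = fedAvg F j₁ := by
  have hW : ∀ j, ‖rel F j₀ j - 1‖ ≤ 1 / 100 := fun j => (h j j₀).trans hδ
  have hW' : ∀ j, ‖rel F j₁ j - 1‖ ≤ 1 / 100 := fun j => (h j j₁).trans hδ
  have hrel : ∀ j, rel F j₁ j = rel F j₀ j * ((F j₀ * (F j₁)⁻¹ : 𝔸ˣ) : 𝔸) := fun j => by
    simp only [rel, Units.val_mul, mul_assoc, Units.inv_mul_cancel_left]
  have hg : (((F j₀ * (F j₁)⁻¹)⁻¹ : 𝔸ˣ) : 𝔸) = rel F j₀ j₁ := by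
    simp only [rel, mul_inv_rev, inv_inv, Units.val_mul]
  have hδ0 : 0 ≤ δ := (norm_nonneg _).trans (h j₀ j₀)
  have hXn : ‖fedSol (rel F j₀) - 1‖ ≤ 3 * δ := norm_fedSol_sub_one_le hδ fun j => h j j₀
  have hgn : ‖(((F j₀ * (F j₁)⁻¹)⁻¹ : 𝔸ˣ) : 𝔸) - 1‖ ≤ δ := by rw [hg]; exact h j₁ j₀
  have hY : ‖(((F j₀ * (F j₁)⁻¹)⁻¹ : 𝔸ˣ) : 𝔸) * fedSol (rel F j₀) - 1‖ ≤ 2 / 25 :=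
    (FederbushMean.norm_mul_sub_one_le hgn hXn).trans (by nlinarith)
  have hfed : fed (rel F j₁) ((((F j₀ * (F j₁)⁻¹)⁻¹ : 𝔸ˣ) : 𝔸) * fedSol (rel F j₀)) = 0 := by
    have hj : ∀ j, rel F j₁ j * ((((F j₀ * (F j₁)⁻¹)⁻¹ : 𝔸ˣ) : 𝔸) * fedSol (rel F j₀))
        = rel F j₀ j * fedSol (rel F j₀) := fun j => by
      rw [hrel j, mul_assoc, Units.mul_inv_cancel_left]
    have h0 := fed_fedSol hW
    rw [fed_def] at h0 ⊢
    simpa only [hj] using h0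
  have hsol : fedSol (rel F j₁) = (((F j₀ * (F j₁)⁻¹)⁻¹ : 𝔸ˣ) : 𝔸) * fedSol (rel F j₀) :=
    (fedSol_unique hW' hY hfed).symm
  have hunit : fedUnit (rel F j₁) = (F j₀ * (F j₁)⁻¹)⁻¹ * fedUnit (rel F j₀) :=
    Units.ext (by rw [val_fedUnit, hsol, Units.val_mul, val_fedUnit])
  rw [fedAvg, fedAvg, hunit]
  group

end Mean

/-! ## § 2  (0.11), the (0.12) loops and the average (0.12) under `r_σ`, under the PAIRWISE hypothesis at the sites
involved (no unitarity of the configuration) -/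

section Average

omit [NormOneClass 𝔸] in
/-- **THE AVERAGED CONTOUR VARIABLE (0.11) IS COVARIANT UNDER `r_σ` AT ONE SITE, `U1`-FREE**:
`𝐔_{r_σU}(q, x) = 𝐔_U(r_σq, r_σx)` for EVERY configuration `U` of units whose contour family
`{U(Γ^π_{r_σq, r_σx})}_π` has pairwise relative diameter `≤ 1/100` — the relabelling carries the family at `x` of
`r_σU` onto that family RE-INDEXED by `π ↦ σπ` (`family_permE`), which moves the base contour from `1` to `σ`; by
(0.7) (`fedAvg_comp_equiv` + `fedAvg_base_indep_of_pairwise`) the mean is unchanged.  (`Tavg_permE` of the tree is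
the `U1`-valued regular case.) [cite: Balaban1987RG1, (0.11) p.253][cite: Balaban1987RG1, (0.7) p.253]
[cite: Balaban1987RG1, (2.17) p.269] -/
theorem Tavg_permE_of_pairwise (σ : Equiv.Perm (Fin d)) (U : ZdEdge d → 𝔸ˣ) (x : Fin d → ℤ)
    (h : ∀ i k, ‖rel (fun π : Equiv.Perm (Fin d) => permT L U π (permSite σ x)) k i - 1‖ ≤ 1 / 100) :
    Tavg L (permE σ U) x = Tavg L U (permSite σ x) := by
  set F : Equiv.Perm (Fin d) → 𝔸ˣ := fun π => permT L U π (permSite σ x) with hF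
  have h1 : Tavg L (permE σ U) x = fedAvg (F ∘ (Equiv.mulLeft σ)) 1 := by
    unfold Tavg
    rw [family_permE]
  have h2 : fedAvg (F ∘ (Equiv.mulLeft σ)) 1 = fedAvg F (Equiv.mulLeft σ 1) :=
    fedAvg_comp_equiv F (Equiv.mulLeft σ) 1 fun j => h j _
  have h3 : Tavg L U (permSite σ x) = fedAvg F σ := fedAvg_base_indep_of_pairwise le_rfl h 1 σ
  rw [h1, h2, h3]
  show fedAvg F (σ * 1) = fedAvg F σ
  rw [mul_one]

omit [NormOneClass 𝔸] in
/-- The (0.12) loops are covariant under `r_σ` at one `(c, x)`, `U1`-free: `W_x(r_σU; c) = W_{r_σx}(U; r_σc)` when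
the contour families of `U` at `r_σx` and at `r_σ(x + Le_μ)` have pairwise relative diameter `≤ 1/100`.
[cite: Balaban1987RG1, (0.12) p.254][cite: Balaban1987RG1, (2.17) p.269] -/
theorem loopW_Tavg_permE_of_pairwise (σ : Equiv.Perm (Fin d)) (U : ZdEdge d → 𝔸ˣ) (c : ZdEdge d)
    (x : Fin d → ℤ)
    (h1 : ∀ i k, ‖rel (fun π : Equiv.Perm (Fin d) => permT L U π (permSite σ x)) k i - 1‖ ≤ 1 / 100)
    (h2 : ∀ i k, ‖rel (fun π : Equiv.Perm (Fin d) =>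
      permT L U π (permSite σ (x + Pi.single c.2 (L : ℤ)))) k i - 1‖ ≤ 1 / 100) :
    loopW L (fun U : ZdEdge d → 𝔸ˣ => Tavg L U) (permE σ U) c x
      = loopW L (fun U : ZdEdge d → 𝔸ˣ => Tavg L U) U (permSite σ c.1, σ c.2) (permSite σ x) := by
  rw [loopW_def, loopW_def, Tavg_permE_of_pairwise σ U x h1, Tavg_permE_of_pairwise σ U _ h2, lineR_permE,
    Ustr_permE, permSite_add, permSite_single]

omit [NormOneClass 𝔸] in
/-- **THE AVERAGE (0.12) IS COVARIANT UNDER `r_σ` AT ONE COARSE BOND, `U1`-FREE**: `\overline{r_σU}(c) = Ū(r_σc)` for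
every configuration of units whose contour families at the sites `r_σx`, `r_σ(x + Le_μ)`, `x ∈ B(c₋)`, have pairwise
relative diameter `≤ 1/100` (block sums re-indexed by `r_σ`, `sum_blockSites_permSite`; loops by
`loopW_Tavg_permE_of_pairwise`). [cite: Balaban1987RG1, (0.12) p.254][cite: Balaban1987RG1, (2.17) p.269] -/
theorem avgBar_permE_of_pairwise (hL : 0 < L) (σ : Equiv.Perm (Fin d)) (U : ZdEdge d → 𝔸ˣ) (c : ZdEdge d)
    (h : ∀ x ∈ blockSites L c.1,
      (∀ i k, ‖rel (fun π : Equiv.Perm (Fin d) => permT L U π (permSite σ x)) k i - 1‖ ≤ 1 / 100) ∧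
      (∀ i k, ‖rel (fun π : Equiv.Perm (Fin d) =>
        permT L U π (permSite σ (x + Pi.single c.2 (L : ℤ)))) k i - 1‖ ≤ 1 / 100)) :
    avgBar L (permE σ U) c = avgBar L U (permSite σ c.1, σ c.2) := by
  unfold avgBar avgM
  dsimp only
  have hsum : ∀ x ∈ blockSites L c.1,
      ((L : ℂ) ^ d)⁻¹ • MatrixLog.mlog ((loopW L (fun U : ZdEdge d → 𝔸ˣ => Tavg L U) (permE σ U) c x : 𝔸ˣ) : 𝔸)
        = ((L : ℂ) ^ d)⁻¹ • MatrixLog.mlog ((loopW L (fun U : ZdEdge d → 𝔸ˣ => Tavg L U) U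
            (permSite σ c.1, σ c.2) (permSite σ x) : 𝔸ˣ) : 𝔸) := fun x hx => by
    rw [loopW_Tavg_permE_of_pairwise σ U c x (h x hx).1 (h x hx).2]
  rw [Ustr_permE, sum_blockSites_permSite hL]
  congr 2
  exact Finset.sum_congr rfl hsum

end Average

/-! ## § 3  The contour families of a perturbed configuration have small PAIRWISE relative diameter -/

section Pairwise

variable {V V' : ZdEdge d → 𝔸ˣ} {B : ZdEdge d → 𝔸} {ρ Θ β ε₀ : ℝ}

omit [NormedAlgebra ℂ 𝔸] [NormOneClass 𝔸] [CompleteSpace 𝔸] in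
/-- `‖a′b′ − ab‖ ≤ α‖b′‖ + ‖a‖β` bookkeeping. [folklore] -/
private theorem norm_mul_sub_mul_le' {a a' b b' : 𝔸} {α β' na nb' : ℝ} (ha : ‖a' - a‖ ≤ α) (hb : ‖b' - b‖ ≤ β')
    (hna : ‖a‖ ≤ na) (hnb' : ‖b'‖ ≤ nb') (hα : 0 ≤ α) : ‖a' * b' - a * b‖ ≤ α * nb' + na * β' := by
  have e : a' * b' - a * b = (a' - a) * b' + a * (b' - b) := by noncomm_ring
  rw [e]
  refine (norm_add_le _ _).trans (add_le_add ?_ ?_)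
  · exact (norm_mul_le _ _).trans (mul_le_mul ha hnb' (norm_nonneg _) hα)
  · exact (norm_mul_le _ _).trans (mul_le_mul hna hb (norm_nonneg _) ((norm_nonneg _).trans hna))

omit [NormedAlgebra ℂ 𝔸] [CompleteSpace 𝔸] in
/-- **THE PAIRWISE RELATIVE FAMILY OF A PERTURBED CONFIGURATION**: at a bondwise-`U1`, `ε₀`-regular `V` and a
configuration `V′` with `‖V′(b) − V(b)‖, ‖V′(b)⁻¹ − V(b)⁻¹‖ ≤ ρ`, `(1 + ρ)^{dL} − 1 ≤ Θ ≤ 1`: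
`‖V′(Γ^i_{q,x})V′(Γ^k_{q,x})⁻¹ − 1‖ ≤ 2(dL)²ε₀ + 3Θ` for ALL pairs `i, k` (the tree's
`B12LQLocalityBound267.norm_rel_permT_sub_one_le` is the base pair `k = 1`): the `U1`-family of `V` has pairwise diameter
`≤ 2(dL)²ε₀` (`rel_permT_pair_small`) and each transporter moves by `≤ Θ` (`norm_permT_sub_le`).
[cite: Balaban1987RG1, (0.11) p.253][cite: Balaban1987RG1, p.252] -/
theorem norm_rel_pair_pert_sub_one_le (hL : 0 < L) (hV : ∀ b, V b ∈ U1 𝔸) (hρ : 0 ≤ ρ)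
    (hρΘ : (1 + ρ) ^ (d * L) - 1 ≤ Θ) (hΘ1 : Θ ≤ 1) (h1 : ∀ b, ‖((V' b : 𝔸ˣ) : 𝔸) - V b‖ ≤ ρ)
    (h2 : ∀ b, ‖(((V' b)⁻¹ : 𝔸ˣ) : 𝔸) - (((V b)⁻¹ : 𝔸ˣ) : 𝔸)‖ ≤ ρ) (hε₀ : 0 ≤ ε₀)
    (h44 : ∀ (p : Fin d → ℤ) (i j : Fin d), i ≠ j → ‖((plaquetteHolonomyZd V p i j : 𝔸ˣ) : 𝔸) - 1‖ ≤ ε₀)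
    (x : Fin d → ℤ) (i k : Equiv.Perm (Fin d)) :
    ‖rel (fun π : Equiv.Perm (Fin d) => permT L V' π x) k i - 1‖ ≤ 2 * (((d : ℝ) * L) ^ 2 * ε₀) + 3 * Θ := by
  haveI : NeZero L := ⟨hL.ne'⟩
  have hU : ∀ b, ‖((V b : 𝔸ˣ) : 𝔸)‖ ≤ 1 := fun b => (mem_U1.1 (hV b)).1
  have hU' : ∀ b, ‖(((V b)⁻¹ : 𝔸ˣ) : 𝔸)‖ ≤ 1 := fun b => (mem_U1.1 (hV b)).2
  have hx : x ∈ blockSites L (blockMap L x) := (mem_blockSites_iff L _ x).2 rfl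
  have hpair : ‖rel (fun π : Equiv.Perm (Fin d) => permT L V π x) k i - 1‖ ≤ 2 * (((d : ℝ) * L) ^ 2 * ε₀) :=
    rel_permT_pair_small hL V hU hU' hε₀ hx (fun p i j hij _ _ => h44 p i j hij) i k
  have hΘ : 0 ≤ Θ := (sub_nonneg.2 (one_le_pow₀ (by linarith))).trans hρΘ
  obtain ⟨hi1, -⟩ := norm_permT_sub_le (V' := V') hL hV hρ h1 h2 i x
  obtain ⟨-, hk2⟩ := norm_permT_sub_le (V' := V') hL hV hρ h1 h2 k x
  have him := mem_U1.1 (permT_mem_U1 (L := L) V hU hU' i x)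
  have hkm := mem_U1.1 (permT_mem_U1 (L := L) V hU hU' k x)
  have hnk' : ‖(((permT L V' k x)⁻¹ : 𝔸ˣ) : 𝔸)‖ ≤ 1 + Θ := by
    have htri := norm_le_norm_add_norm_sub' (((permT L V' k x)⁻¹ : 𝔸ˣ) : 𝔸) (((permT L V k x)⁻¹ : 𝔸ˣ) : 𝔸)
    linarith [hkm.2, hk2.trans hρΘ]
  have hdiff : ‖rel (fun π : Equiv.Perm (Fin d) => permT L V' π x) k i
      - rel (fun π : Equiv.Perm (Fin d) => permT L V π x) k i‖ ≤ 3 * Θ := by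
    simp only [rel]
    calc _ ≤ Θ * (1 + Θ) + 1 * Θ := norm_mul_sub_mul_le' (hi1.trans hρΘ) (hk2.trans hρΘ) him.1 hnk' hΘ
      _ ≤ 3 * Θ := by nlinarith
  calc _ ≤ ‖rel (fun π : Equiv.Perm (Fin d) => permT L V' π x) k i
          - rel (fun π : Equiv.Perm (Fin d) => permT L V π x) k i‖
        + ‖rel (fun π : Equiv.Perm (Fin d) => permT L V π x) k i - 1‖ := norm_sub_le_norm_sub_add_norm_sub _ _ _
    _ ≤ _ := by linarith

/-- The size bookkeeping of the bond perturbation `V′V = e^{iB′}V` on the ball `sup‖B′‖·dL ≤ 1/1200` (as in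
`B12Def267Covariance`): `ρ = e^{β} − 1`, `(1 + ρ)^{dL} − 1 ≤ Θ := y/(1 − y) < 1/600` for `y = β·dL`. [folklore] -/
private theorem theta_of_ball (hV : ∀ b, V b ∈ U1 𝔸) (hB : ∀ b, ‖B b‖ ≤ β) (b₀ : ZdEdge d)
    (hβ : β * ((d : ℝ) * L) ≤ 1 / 1200) :
    ∃ ρ Θ : ℝ, 0 ≤ ρ ∧ (1 + ρ) ^ (d * L) - 1 ≤ Θ ∧ Θ < 1 / 600 ∧
      (∀ b, ‖((pert B V b : 𝔸ˣ) : 𝔸) - V b‖ ≤ ρ) ∧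
      (∀ b, ‖(((pert B V b)⁻¹ : 𝔸ˣ) : 𝔸) - (((V b)⁻¹ : 𝔸ˣ) : 𝔸)‖ ≤ ρ) := by
  have hβ0 : 0 ≤ β := (norm_nonneg _).trans (hB b₀)
  set y : ℝ := β * ((d : ℝ) * L) with hy
  have hy0 : 0 ≤ y := by positivity
  have hy1 : y < 1 := by linarith
  have hpert : ∀ b, ‖((pert B V b : 𝔸ˣ) : 𝔸) - V b‖ ≤ Real.exp β - 1 ∧
      ‖(((pert B V b)⁻¹ : 𝔸ˣ) : 𝔸) - (((V b)⁻¹ : 𝔸ˣ) : 𝔸)‖ ≤ Real.exp β - 1 := by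
    intro b
    have h := norm_pert_smul_sub_le hV hB (1 : ℂ) b
    rw [one_smul, norm_one, one_mul] at h
    exact h
  refine ⟨Real.exp β - 1, y / (1 - y), sub_nonneg.2 (Real.one_le_exp hβ0), ?_, ?_,
    fun b => (hpert b).1, fun b => (hpert b).2⟩
  · have hpow : (1 + (Real.exp β - 1)) ^ (d * L) - 1 = Real.exp y - 1 := by
      rw [add_sub_cancel, ← Real.exp_nat_mul, show ((d * L : ℕ) : ℝ) * β = y by rw [hy]; push_cast; ring]
    rw [hpow]
    have h := Real.exp_bound_div_one_sub_of_interval hy0 hy1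
    have hne : 1 - y ≠ 0 := by linarith
    have : y / (1 - y) = 1 / (1 - y) - 1 := by field_simp; ring
    linarith
  · rw [div_lt_iff₀ (by linarith)]
    linarith

/-- **ON THE BALL THE PERTURBED FAMILIES ARE IN THE DOMAIN OF (0.10), PAIRWISE**: at a bondwise-`U1`, `ε₀`-regular `V`
with `(dL)²ε₀ ≤ 1/400` (`d ≥ 1`) and `sup_b‖B′(b)‖·dL ≤ 1/1200`, every contour family of `V′V = e^{iB′}V` has pairwise
relative diameter `≤ 1/100` (`2(dL)²ε₀ ≤ 1/200` plus `3Θ < 1/200`). [cite: Balaban1987RG1, (0.11) p.253]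
[cite: Balaban1987RG1, p.265] -/
theorem rel_pair_pert_le_of_ball (hL : 0 < L) (hd : 1 ≤ d) (hV : ∀ b, V b ∈ U1 𝔸) (hε₀ : 0 ≤ ε₀)
    (hsm4 : ((d : ℝ) * L) ^ 2 * ε₀ ≤ 1 / 400)
    (h44 : ∀ (p : Fin d → ℤ) (i j : Fin d), i ≠ j → ‖((plaquetteHolonomyZd V p i j : 𝔸ˣ) : 𝔸) - 1‖ ≤ ε₀)
    (hB : ∀ b, ‖B b‖ ≤ β) (hβ : β * ((d : ℝ) * L) ≤ 1 / 1200) (x : Fin d → ℤ) (i k : Equiv.Perm (Fin d)) :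
    ‖rel (fun π : Equiv.Perm (Fin d) => permT L (pert B V) π x) k i - 1‖ ≤ 1 / 100 := by
  obtain ⟨ρ, Θ, hρ, hρΘ, hΘ, h1, h2⟩ := theta_of_ball hV hB (x, ⟨0, hd⟩) hβ
  have h := norm_rel_pair_pert_sub_one_le hL hV hρ hρΘ (by linarith) h1 h2 hε₀ h44 x i k
  linarith

end Pairwise

/-! ## § 4  `Q̃` of (2.4) and its linear part `LQ̃` under `r_σ` -/

section Qtilde

variable {V : ZdEdge d → 𝔸ˣ} {β ε₀ : ℝ}

omit [NormOneClass 𝔸] in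
/-- `(r_σV′)(r_σV) = r_σ(V′V)` for `V′ = e^{iB′}` bondwise (elementary API). [cite: Balaban1987RG1, (2.17) p.269] -/
theorem pert_permE (σ : Equiv.Perm (Fin d)) (B' : ZdEdge d → 𝔸) (V : ZdEdge d → 𝔸ˣ) :
    pert (permE σ B') (permE σ V) = permE σ (pert B' V) :=
  funext fun _ => rfl

omit [NormOneClass 𝔸] in
/-- **(2.4)'s `Q̃` IS COVARIANT UNDER `r_σ` AT ONE COARSE BOND, `U1`-FREE FORM**:
`Q̃_{r_σV}(r_σB′)(c) = Q̃_V(B′)(r_σc)` whenever the contour families of `V` and of `V′V = e^{iB′}V` at the sites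
`r_σx`, `r_σ(x + Le_μ)`, `x ∈ B(c₋)`, have pairwise relative diameter `≤ 1/100`.
[cite: Balaban1987RG1, (2.4) p.266][cite: Balaban1987RG1, (2.17) p.269] -/
theorem Qtilde_permE_of_pairwise (hL : 0 < L) (σ : Equiv.Perm (Fin d)) (V : ZdEdge d → 𝔸ˣ) (B' : ZdEdge d → 𝔸)
    (c : ZdEdge d)
    (hV : ∀ x ∈ blockSites L c.1,
      (∀ i k, ‖rel (fun π : Equiv.Perm (Fin d) => permT L V π (permSite σ x)) k i - 1‖ ≤ 1 / 100) ∧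
      (∀ i k, ‖rel (fun π : Equiv.Perm (Fin d) =>
        permT L V π (permSite σ (x + Pi.single c.2 (L : ℤ)))) k i - 1‖ ≤ 1 / 100))
    (hB : ∀ x ∈ blockSites L c.1,
      (∀ i k, ‖rel (fun π : Equiv.Perm (Fin d) => permT L (pert B' V) π (permSite σ x)) k i - 1‖ ≤ 1 / 100) ∧
      (∀ i k, ‖rel (fun π : Equiv.Perm (Fin d) =>
        permT L (pert B' V) π (permSite σ (x + Pi.single c.2 (L : ℤ)))) k i - 1‖ ≤ 1 / 100)) :
    Qtilde L (fun U : ZdEdge d → 𝔸ˣ => Tavg L U) (permE σ V) (permE σ B') c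
      = Qtilde L (fun U : ZdEdge d → 𝔸ˣ => Tavg L U) V B' (permSite σ c.1, σ c.2) := by
  unfold Qtilde
  rw [pert_permE]
  change (-Complex.I) • MatrixLog.mlog (((avgBar L (permE σ (pert B' V)) c * (avgBar L (permE σ V) c)⁻¹ : 𝔸ˣ) : 𝔸))
    = (-Complex.I) • MatrixLog.mlog (((avgBar L (pert B' V) (permSite σ c.1, σ c.2)
        * (avgBar L V (permSite σ c.1, σ c.2))⁻¹ : 𝔸ˣ) : 𝔸))
  rw [avgBar_permE_of_pairwise hL σ _ c hB, avgBar_permE_of_pairwise hL σ V c hV]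

/-- **`Q̃_{r_σV}(r_σB′)(c) = Q̃_V(B′)(r_σc)` ON THE BALL**: at a bondwise-`U1`, `ε₀`-regular `V` with `(dL)²ε₀ ≤ 1/400`
(`d ≥ 1`), for every `B′` with `sup_b‖B′(b)‖·dL ≤ 1/1200` and every axis permutation `σ` — the finite identity at the
COMPLEX perturbation `e^{iB′}V` (not `U1`-valued), by § 3. [cite: Balaban1987RG1, (2.4) p.266]
[cite: Balaban1987RG1, (2.17) p.269] -/
theorem Qtilde_permE_of_ball (hL : 0 < L) (hd : 1 ≤ d) (σ : Equiv.Perm (Fin d)) (hV : ∀ b, V b ∈ U1 𝔸)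
    (hε₀ : 0 ≤ ε₀) (hsm4 : ((d : ℝ) * L) ^ 2 * ε₀ ≤ 1 / 400)
    (h44 : ∀ (p : Fin d → ℤ) (i j : Fin d), i ≠ j → ‖((plaquetteHolonomyZd V p i j : 𝔸ˣ) : 𝔸) - 1‖ ≤ ε₀)
    {B' : ZdEdge d → 𝔸} (hB : ∀ b, ‖B' b‖ ≤ β) (hβ : β * ((d : ℝ) * L) ≤ 1 / 1200) (c : ZdEdge d) :
    Qtilde L (fun U : ZdEdge d → 𝔸ˣ => Tavg L U) (permE σ V) (permE σ B') c
      = Qtilde L (fun U : ZdEdge d → 𝔸ˣ => Tavg L U) V B' (permSite σ c.1, σ c.2) := by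
  haveI : NeZero L := ⟨hL.ne'⟩
  have hU : ∀ b, ‖((V b : 𝔸ˣ) : 𝔸)‖ ≤ 1 := fun b => (mem_U1.1 (hV b)).1
  have hU' : ∀ b, ‖(((V b)⁻¹ : 𝔸ˣ) : 𝔸)‖ ≤ 1 := fun b => (mem_U1.1 (hV b)).2
  have hPV : ∀ (y : Fin d → ℤ) (i k : Equiv.Perm (Fin d)),
      ‖rel (fun π : Equiv.Perm (Fin d) => permT L V π y) k i - 1‖ ≤ 1 / 100 := fun y i k =>
    (rel_permT_pair_small hL V hU hU' hε₀ ((mem_blockSites_iff L _ y).2 rfl)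
      (fun p i j hij _ _ => h44 p i j hij) i k).trans (by linarith)
  have hPB : ∀ (y : Fin d → ℤ) (i k : Equiv.Perm (Fin d)),
      ‖rel (fun π : Equiv.Perm (Fin d) => permT L (pert B' V) π y) k i - 1‖ ≤ 1 / 100 := fun y i k =>
    rel_pair_pert_le_of_ball hL hd hV hε₀ hsm4 h44 hB hβ y i k
  exact Qtilde_permE_of_pairwise hL σ V B' c (fun x _ => ⟨hPV _, hPV _⟩) (fun x _ => ⟨hPB _, hPB _⟩)

/-- **ALONG A LINE `s ↦ sB′` THE IDENTITY HOLDS FOR ALL SMALL `s`, ANY `B′`**: at a bondwise-`U1`, `ε₀`-regular `V`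
with `(dL)²ε₀ < 1/200`, `Q̃_{r_σV}(s·r_σB′)(c) = Q̃_V(sB′)(r_σc)` eventually as `s → 0` — the finitely many contour
families involved depend continuously (analytically, `B12Average012Analytic.analyticAt_permT`) on `s` and have pairwise
diameter `≤ 2(dL)²ε₀ < 1/100` at `s = 0`. [cite: Balaban1987RG1, (2.4) p.266][cite: Balaban1987RG1, (2.17) p.269] -/
theorem Qtilde_permE_eventually (hL : 0 < L) (σ : Equiv.Perm (Fin d)) (V : ZdEdge d → 𝔸ˣ)
    (hV : ∀ b, V b ∈ U1 𝔸) (hε₀ : 0 ≤ ε₀) (hsm : ((d : ℝ) * L) ^ 2 * ε₀ < 1 / 200)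
    (h44 : ∀ (p : Fin d → ℤ) (i j : Fin d), i ≠ j → ‖((plaquetteHolonomyZd V p i j : 𝔸ˣ) : 𝔸) - 1‖ ≤ ε₀)
    (B' : ZdEdge d → 𝔸) (c : ZdEdge d) :
    ∀ᶠ s : ℂ in 𝓝 0, Qtilde L (fun U : ZdEdge d → 𝔸ˣ => Tavg L U) (permE σ V) (s • permE σ B') c
      = Qtilde L (fun U : ZdEdge d → 𝔸ˣ => Tavg L U) V (s • B') (permSite σ c.1, σ c.2) := by
  haveI : NeZero L := ⟨hL.ne'⟩
  have hU : ∀ b, ‖((V b : 𝔸ˣ) : 𝔸)‖ ≤ 1 := fun b => (mem_U1.1 (hV b)).1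
  have hU' : ∀ b, ‖(((V b)⁻¹ : 𝔸ˣ) : 𝔸)‖ ≤ 1 := fun b => (mem_U1.1 (hV b)).2
  -- the analytic line `s ↦ e^{isB′}V`
  set U : ℂ → ZdEdge d → 𝔸ˣ := fun s => pert (s • B') V with hUdef
  have hUa : ∀ b, AnalyticAt ℂ (fun s : ℂ => ((U s b : 𝔸ˣ) : 𝔸)) 0 :=
    analyticAt_pert (fun s : ℂ => s • B') (fun b => analyticAt_id.smul analyticAt_const) V
  have hU0 : U 0 = V := by simp only [hUdef, zero_smul, pert_zero]
  -- the families of `V` are pairwise STRICTLY inside the domain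
  have hPV : ∀ (y : Fin d → ℤ) (i k : Equiv.Perm (Fin d)),
      ‖rel (fun π : Equiv.Perm (Fin d) => permT L V π y) k i - 1‖ < 1 / 100 := fun y i k =>
    (rel_permT_pair_small hL V hU hU' hε₀ ((mem_blockSites_iff L _ y).2 rfl)
      (fun p i j hij _ _ => h44 p i j hij) i k).trans_lt (by linarith)
  -- by continuity the perturbed families stay inside for small `s`, at any fixed site
  have hev : ∀ y : Fin d → ℤ, ∀ᶠ s : ℂ in 𝓝 0, ∀ i k : Equiv.Perm (Fin d),
      ‖rel (fun π : Equiv.Perm (Fin d) => permT L (U s) π y) k i - 1‖ ≤ 1 / 100 := by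
    intro y
    refine Filter.eventually_all.2 fun i => ?_
    refine Filter.eventually_all.2 fun k => ?_
    have ha : AnalyticAt ℂ (fun s : ℂ => rel (fun π : Equiv.Perm (Fin d) => permT L (U s) π y) k i) 0 := by
      simp only [rel]
      exact (analyticAt_permT (L := L) U hUa i y).fun_mul
        (analyticAt_units_inv (analyticAt_permT (L := L) U hUa k y))
    have hc : ContinuousAt (fun s : ℂ =>
        ‖rel (fun π : Equiv.Perm (Fin d) => permT L (U s) π y) k i - 1‖) 0 :=
      (ha.continuousAt.sub continuousAt_const).norm
    have h0 : ‖rel (fun π : Equiv.Perm (Fin d) => permT L (U 0) π y) k i - 1‖ < 1 / 100 := by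
      rw [hU0]; exact hPV y i k
    exact (hc.eventually_lt continuousAt_const h0).mono fun s hs => hs.le
  -- collect over the finitely many sites entering `Ū(r_σc)`
  have hall : ∀ᶠ s : ℂ in 𝓝 0, ∀ x ∈ blockSites L c.1,
      (∀ i k : Equiv.Perm (Fin d),
        ‖rel (fun π : Equiv.Perm (Fin d) => permT L (U s) π (permSite σ x)) k i - 1‖ ≤ 1 / 100) ∧
      (∀ i k : Equiv.Perm (Fin d), ‖rel (fun π : Equiv.Perm (Fin d) =>
        permT L (U s) π (permSite σ (x + Pi.single c.2 (L : ℤ)))) k i - 1‖ ≤ 1 / 100) := by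
    rw [Filter.eventually_all_finset]
    intro x _
    exact (hev _).and (hev _)
  filter_upwards [hall] with s hs
  have e : s • permE σ B' = permE σ (s • B') := by funext b; rfl
  simp only [hUdef] at hs
  rw [e]
  exact Qtilde_permE_of_pairwise hL σ V (s • B') c
    (fun x _ => ⟨fun i k => (hPV _ i k).le, fun i k => (hPV _ i k).le⟩) hs

/-- **THE LINEAR PART `LQ̃` OF (2.4) IS COVARIANT UNDER THE AXIS PERMUTATIONS (2.17)**:
`LQ̃_{r_σV}(r_σB′)(c) = LQ̃_V(B′)(r_σc)` for EVERY coarse field `B′` (no boundedness), at a bondwise-`U1`, `ε₀`-regular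
`V` with `(dL)²ε₀ < 1/200` — the two sides of `Qtilde_permE_eventually` have the same derivative at `s = 0`
(`Filter.EventuallyEq.deriv_eq`).  Companion of `B12Average012QtildeCovariance.LQ_gaugeTransformZd` ((2.16)) and
`LQ_shiftE` (translations). [cite: Balaban1987RG1, p.267][cite: Balaban1987RG1, (2.17) p.269] -/
theorem LQ_permE (hL : 0 < L) (σ : Equiv.Perm (Fin d)) (V : ZdEdge d → 𝔸ˣ) (hV : ∀ b, V b ∈ U1 𝔸) (hε₀ : 0 ≤ ε₀)
    (hsm : ((d : ℝ) * L) ^ 2 * ε₀ < 1 / 200)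
    (h44 : ∀ (p : Fin d → ℤ) (i j : Fin d), i ≠ j → ‖((plaquetteHolonomyZd V p i j : 𝔸ˣ) : 𝔸) - 1‖ ≤ ε₀)
    (B' : ZdEdge d → 𝔸) (c : ZdEdge d) :
    LQ L (fun U : ZdEdge d → 𝔸ˣ => Tavg L U) (permE σ V) (permE σ B') c
      = LQ L (fun U : ZdEdge d → 𝔸ˣ => Tavg L U) V B' (permSite σ c.1, σ c.2) := by
  unfold LQ
  exact Filter.EventuallyEq.deriv_eq (Qtilde_permE_eventually hL σ V hV hε₀ hsm h44 B' c)

end Qtilde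

/-! ## § 5  The operator `h` of p. 267 under `r_σ`, by uniqueness -/

section HOperator

omit [NormedRing 𝔸] [NormedAlgebra ℂ 𝔸] [NormOneClass 𝔸] [CompleteSpace 𝔸] in
/-- **`{b₀(c)}` IS `r_σ`-STABLE**: `r_σ(b₀(c)) = b₀(r_σ c)` — the corridor bond `b₀(c) = (Lc₋ + (L−1)e_μ, μ)` of
`c = (c₋, μ)` goes to the corridor bond of `r_σc = (r_σc₋, σμ)` (elementary API). [cite: Balaban1987RG1, p.267] -/
theorem permBond_b0Z (σ : Equiv.Perm (Fin d)) (c : ZdEdge d) :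
    ((permSite σ (b0Z L c).1, σ (b0Z L c).2) : ZdEdge d) = b0Z L (permSite σ c.1, σ c.2) := by
  simp only [b0Z, permSite_add, permSite_single, permSite_blockBase]

omit [NormedAlgebra ℂ 𝔸] [NormOneClass 𝔸] [CompleteSpace 𝔸] in
/-- «The function hB is equal to 0 everywhere, except the set {b₀(c)}» is preserved by the relabelling on both sides:
`B ↦ r_σ⁻¹(hOp b₀ h (r_σB))` is corridor-supported. [cite: Balaban1987RG1, p.267] -/
theorem corridorSupported_permE_hOp (σ : Equiv.Perm (Fin d)) (h : ZdEdge d → 𝔸 → 𝔸) :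
    CorridorSupported L (fun B : ZdEdge d → 𝔸 => permE σ⁻¹ (hOp (b0Z (d := d) L) h (permE σ B))) := by
  intro B b hb
  show permE σ⁻¹ (hOp (b0Z L) h (permE σ B)) b = 0
  rw [permE_apply]
  refine hOp_eq_zero_off_range _ _ fun ⟨c, hc⟩ => hb ⟨(permSite σ c.1, σ c.2), ?_⟩
  rw [← permBond_b0Z, hc]
  simp only [permSite_permSite_inv, Equiv.Perm.coe_inv, Equiv.apply_symm_apply, Prod.mk.eta]

/-- **THE OPERATOR `h` OF P. 267 IS COVARIANT UNDER THE AXIS PERMUTATIONS (2.17)**: for a `U1`-valued `ε₀`-regular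
background `V` (`(dL)²ε₀ < 1/200`, `d ≥ 1`) and an axis permutation `σ`, the corridor operator at the relabelled
background applied to the relabelled coarse field is the relabelled corridor operator: `h_{r_σV}(r_σB) = r_σ(h_V B)`
— for ANY witnesses of the hypotheses of `hAverage` at `V` and at `r_σV` (`‖·‖ ≤ 1`, regularity, `ω_A(ε₀) ≤ 1/8`,
Neumann budget; `permE_mem_U1` / `permE_regular` supply some).  PROOF = print's «Of course h is uniquely defined by
these conditions»: `r_σ⁻¹ ∘ h_{r_σV} ∘ r_σ` is a corridor-supported right inverse of `LQ̃_V` (covariance of `LQ̃`,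
`LQ_permE`, at `(r_σV, σ⁻¹)`), hence equals `h_V` (`h_paragraph_p267_average`, clause (ii)).
[cite: Balaban1987RG1, p.267][cite: Balaban1987RG1, (2.17) p.269] -/
theorem hOp_hAverage_permE (hL : 0 < L) (hd : 1 ≤ d) (σ : Equiv.Perm (Fin d)) (V : ZdEdge d → 𝔸ˣ)
    (hV : ∀ b, V b ∈ U1 𝔸) {ε₀ : ℝ} (hε₀ : 0 ≤ ε₀) (hsm : ((d : ℝ) * L) ^ 2 * ε₀ < 1 / 200)
    (h44 : ∀ (p : Fin d → ℤ) (i j : Fin d), i ≠ j → ‖((plaquetteHolonomyZd V p i j : 𝔸ˣ) : 𝔸) - 1‖ ≤ ε₀)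
    (hV₁ : ∀ b, ‖((V b : 𝔸ˣ) : 𝔸)‖ ≤ 1) (hV₂ : ∀ b, ‖(((V b)⁻¹ : 𝔸ˣ) : 𝔸)‖ ≤ 1)
    (hsmV : ((d : ℝ) * L) ^ 2 * ε₀ ≤ 1 / 100) (hωV : omegaA d L ε₀ ≤ 1 / 8)
    (hbudV : (L : ℝ) ^ d / L * (24 * omegaA d L ε₀) < 1)
    (hU₁ : ∀ b, ‖((permE σ V b : 𝔸ˣ) : 𝔸)‖ ≤ 1) (hU₂ : ∀ b, ‖(((permE σ V b)⁻¹ : 𝔸ˣ) : 𝔸)‖ ≤ 1)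
    (h44U : ∀ (p : Fin d → ℤ) (i j : Fin d), i ≠ j →
      ‖((plaquetteHolonomyZd (permE σ V) p i j : 𝔸ˣ) : 𝔸) - 1‖ ≤ ε₀)
    (hsmU : ((d : ℝ) * L) ^ 2 * ε₀ ≤ 1 / 100) (hωU : omegaA d L ε₀ ≤ 1 / 8)
    (hbudU : (L : ℝ) ^ d / L * (24 * omegaA d L ε₀) < 1)
    (B : ZdEdge d → 𝔸) :
    hOp (b0Z L) (fun c X => hAverage hL hd (permE σ V) hU₁ hU₂ hε₀ h44U hsmU hωU hbudU c X) (permE σ B)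
      = permE σ (hOp (b0Z L) (fun c X => hAverage hL hd V hV₁ hV₂ hε₀ h44 hsmV hωV hbudV c X) B) := by
  -- the `h`-paragraphs at `r_σV` («LQ̃h = I» there) and at `V` (uniqueness here)
  obtain ⟨hiU, -, -⟩ := h_paragraph_p267_average hL hd (permE σ V) hU₁ hU₂ hε₀ h44U hsmU hωU hbudU
  obtain ⟨-, huniq, -⟩ := h_paragraph_p267_average hL hd V hV₁ hV₂ hε₀ h44 hsmV hωV hbudV
  -- name the two fibre families (opaque from here on)
  generalize hUdef : (fun c X => hAverage hL hd (permE σ V) hU₁ hU₂ hε₀ h44U hsmU hωU hbudU c X) = hU at hiU ⊢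
  generalize hV0def : (fun c X => hAverage hL hd V hV₁ hV₂ hε₀ h44 hsmV hωV hbudV c X) = hV0 at huniq ⊢
  -- the candidate `𝒽 = r_σ⁻¹ ∘ h_{r_σV} ∘ r_σ`
  set 𝒽 : (ZdEdge d → 𝔸) → ZdEdge d → 𝔸 :=
    fun B => permE σ⁻¹ (hOp (b0Z L) hU (permE σ B)) with h𝒽def
  have hs : CorridorSupported L 𝒽 := by
    rw [h𝒽def]
    exact corridorSupported_permE_hOp σ hU
  -- right inverse of `LQ̃_V`, by the covariance of `LQ̃` at `(r_σV, σ⁻¹)`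
  have hVU : ∀ b, permE σ V b ∈ U1 𝔸 := permE_mem_U1 σ hV
  have hinv : ∀ B c, LQ L (fun U : ZdEdge d → 𝔸ˣ => Tavg L U) V (𝒽 B) c = B c := by
    intro B c
    have hcov := LQ_permE hL σ⁻¹ (permE σ V) hVU hε₀ hsm (permE_regular σ h44)
      (hOp (b0Z L) hU (permE σ B)) c
    rw [← permE_mul, mul_inv_cancel, permE_one] at hcov
    rw [h𝒽def]
    show LQ L (fun U : ZdEdge d → 𝔸ˣ => Tavg L U) V (permE σ⁻¹ (hOp (b0Z L) hU (permE σ B))) c = B c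
    rw [hcov, hiU, permE_apply]
    simp only [permSite_permSite_inv, Equiv.Perm.coe_inv, Equiv.apply_symm_apply, Prod.mk.eta]
  -- uniqueness: `𝒽 = h_V`
  have heq : 𝒽 = hOp (b0Z L) hV0 := huniq 𝒽 hs hinv
  have hB : 𝒽 B = hOp (b0Z L) hV0 B := congrFun heq B
  rw [h𝒽def] at hB
  calc hOp (b0Z L) hU (permE σ B)
      = permE σ (permE σ⁻¹ (hOp (b0Z L) hU (permE σ B))) := by rw [← permE_mul, inv_mul_cancel, permE_one]
    _ = permE σ (hOp (b0Z L) hV0 B) := by rw [← hB]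

/-- **THE FIBRE FORM**: «(hB)(b₀(c)) = h(c)B(c)» — `h_{r_σV}(c) = h_V(r_σc)` as linear maps of `𝐠` (the coarse
rotation moves the bond, not the fibre), any witnesses. [cite: Balaban1987RG1, p.267] -/
theorem hAverage_permE_apply (hL : 0 < L) (hd : 1 ≤ d) (σ : Equiv.Perm (Fin d)) (V : ZdEdge d → 𝔸ˣ)
    (hV : ∀ b, V b ∈ U1 𝔸) {ε₀ : ℝ} (hε₀ : 0 ≤ ε₀) (hsm : ((d : ℝ) * L) ^ 2 * ε₀ < 1 / 200)
    (h44 : ∀ (p : Fin d → ℤ) (i j : Fin d), i ≠ j → ‖((plaquetteHolonomyZd V p i j : 𝔸ˣ) : 𝔸) - 1‖ ≤ ε₀)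
    (hV₁ : ∀ b, ‖((V b : 𝔸ˣ) : 𝔸)‖ ≤ 1) (hV₂ : ∀ b, ‖(((V b)⁻¹ : 𝔸ˣ) : 𝔸)‖ ≤ 1)
    (hsmV : ((d : ℝ) * L) ^ 2 * ε₀ ≤ 1 / 100) (hωV : omegaA d L ε₀ ≤ 1 / 8)
    (hbudV : (L : ℝ) ^ d / L * (24 * omegaA d L ε₀) < 1)
    (hU₁ : ∀ b, ‖((permE σ V b : 𝔸ˣ) : 𝔸)‖ ≤ 1) (hU₂ : ∀ b, ‖(((permE σ V b)⁻¹ : 𝔸ˣ) : 𝔸)‖ ≤ 1)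
    (h44U : ∀ (p : Fin d → ℤ) (i j : Fin d), i ≠ j →
      ‖((plaquetteHolonomyZd (permE σ V) p i j : 𝔸ˣ) : 𝔸) - 1‖ ≤ ε₀)
    (hsmU : ((d : ℝ) * L) ^ 2 * ε₀ ≤ 1 / 100) (hωU : omegaA d L ε₀ ≤ 1 / 8)
    (hbudU : (L : ℝ) ^ d / L * (24 * omegaA d L ε₀) < 1)
    (c : ZdEdge d) (X : 𝔸) :
    hAverage hL hd (permE σ V) hU₁ hU₂ hε₀ h44U hsmU hωU hbudU c X
      = hAverage hL hd V hV₁ hV₂ hε₀ h44 hsmV hωV hbudV (permSite σ c.1, σ c.2) X := by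
  have h := congrFun (hOp_hAverage_permE hL hd σ V hV hε₀ hsm h44 hV₁ hV₂ hsmV hωV hbudV hU₁ hU₂ h44U hsmU hωU
    hbudU (fun _ => X)) (b0Z L c)
  rw [hOp_apply_b₀ (b0Z_injective hL), permE_apply, permE_apply, permBond_b0Z,
    hOp_apply_b₀ (b0Z_injective hL)] at h
  exact h

/-- The same with the elementary witnesses at `r_σV` (a convenience form). [cite: Balaban1987RG1, p.267] -/
theorem hOp_hAverage_permE' (hL : 0 < L) (hd : 1 ≤ d) (σ : Equiv.Perm (Fin d)) (V : ZdEdge d → 𝔸ˣ)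
    (hV : ∀ b, V b ∈ U1 𝔸) {ε₀ : ℝ} (hε₀ : 0 ≤ ε₀) (hsm : ((d : ℝ) * L) ^ 2 * ε₀ < 1 / 200)
    (hω : omegaA d L ε₀ ≤ 1 / 8) (hbud : (L : ℝ) ^ d / L * (24 * omegaA d L ε₀) < 1)
    (h44 : ∀ (p : Fin d → ℤ) (i j : Fin d), i ≠ j → ‖((plaquetteHolonomyZd V p i j : 𝔸ˣ) : 𝔸) - 1‖ ≤ ε₀)
    (B : ZdEdge d → 𝔸) :
    hOp (b0Z L) (fun c X => hAverage hL hd (permE σ V) (fun b => (mem_U1.1 (permE_mem_U1 σ hV b)).1)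
        (fun b => (mem_U1.1 (permE_mem_U1 σ hV b)).2) hε₀ (permE_regular σ h44) (by linarith) hω hbud c X)
        (permE σ B)
      = permE σ (hOp (b0Z L) (fun c X => hAverage hL hd V (fun b => (mem_U1.1 (hV b)).1)
          (fun b => (mem_U1.1 (hV b)).2) hε₀ h44 (by linarith) hω hbud c X) B) :=
  hOp_hAverage_permE hL hd σ V hV hε₀ hsm h44 _ _ _ _ _ _ _ _ _ _ _ B

end HOperator

/-! ## § 6  The remainder `C̃ = Q̃ − LQ̃` of p. 267 under `r_σ`, on the quantitative small-field ball -/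

section Ctilde

variable {V : ZdEdge d → 𝔸ˣ} {B : ZdEdge d → 𝔸} {β ε₀ : ℝ}

/-- **THE REMAINDER `C̃ = Q̃ − LQ̃` OF P. 267 IS COVARIANT UNDER (2.17)** («LQ̃B′ + C̃(B′)»): on the ball
`sup_b‖B′(b)‖·dL ≤ 1/1200` at a bondwise-`U1`, `ε₀`-regular `V` (`(dL)²ε₀ ≤ 1/400`, `d ≥ 1`), for every axis
permutation `σ`, `C̃_{r_σV}(r_σB′)(c) = C̃_V(B′)(r_σc)` — `Qtilde_permE_of_ball` and `LQ_permE` subtracted.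
[cite: Balaban1987RG1, p.267][cite: Balaban1987RG1, (2.17) p.269] -/
theorem Ctilde_permE (hL : 0 < L) (hd : 1 ≤ d) (σ : Equiv.Perm (Fin d)) (hV : ∀ b, V b ∈ U1 𝔸) (hε₀ : 0 ≤ ε₀)
    (hsm4 : ((d : ℝ) * L) ^ 2 * ε₀ ≤ 1 / 400)
    (h44 : ∀ (p : Fin d → ℤ) (i j : Fin d), i ≠ j → ‖((plaquetteHolonomyZd V p i j : 𝔸ˣ) : 𝔸) - 1‖ ≤ ε₀)
    (hB : ∀ b, ‖B b‖ ≤ β) (hβ : β * ((d : ℝ) * L) ≤ 1 / 1200) (c : ZdEdge d) :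
    Qtilde L (fun U : ZdEdge d → 𝔸ˣ => Tavg L U) (permE σ V) (permE σ B) c
        - LQ L (fun U : ZdEdge d → 𝔸ˣ => Tavg L U) (permE σ V) (permE σ B) c
      = Qtilde L (fun U : ZdEdge d → 𝔸ˣ => Tavg L U) V B (permSite σ c.1, σ c.2)
          - LQ L (fun U : ZdEdge d → 𝔸ˣ => Tavg L U) V B (permSite σ c.1, σ c.2) := by
  rw [Qtilde_permE_of_ball hL hd σ hV hε₀ hsm4 h44 hB hβ c, LQ_permE hL σ V hV hε₀ (by linarith) h44 B c]

end Ctilde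

/-! ## § 7  `r_σ` as a linear isometry of `ℓ^∞`, and the letters of `B12LinearizationGenuineZd` under it -/

section Field

open B12LinearizationGenuineZd (BField hfield Cfield hfield_apply Cfield_apply)

omit [NormedAlgebra ℂ 𝔸] [NormOneClass 𝔸] [CompleteSpace 𝔸] in
/-- (2.17) `B′ ↦ r_σB′` as a self-map of the Banach space `ℓ^∞` of bounded bond fields (a relabelling of the index set
keeps the sup norm), WITH BODY. [cite: Balaban1987RG1, (2.17) p.269] -/
def permBF (σ : Equiv.Perm (Fin d)) (Y : BField d 𝔸) : BField d 𝔸 :=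
  ⟨permE σ ⇑Y, memℓp_infty ⟨‖Y‖, by
    rintro _ ⟨b, rfl⟩
    exact lp.norm_apply_le_norm ENNReal.top_ne_zero Y _⟩⟩

omit [NormedAlgebra ℂ 𝔸] [NormOneClass 𝔸] [CompleteSpace 𝔸] in
/-- Unfolding of `permBF`. [cite: Balaban1987RG1, (2.17) p.269] -/
theorem coe_permBF (σ : Equiv.Perm (Fin d)) (Y : BField d 𝔸) :
    ((permBF σ Y : BField d 𝔸) : ZdEdge d → 𝔸) = permE σ ⇑Y := rfl

omit [NormedAlgebra ℂ 𝔸] [NormOneClass 𝔸] [CompleteSpace 𝔸] in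
/-- `r_σ` does not increase the sup norm. [cite: Balaban1987RG1, (2.17) p.269] -/
theorem norm_permBF_le (σ : Equiv.Perm (Fin d)) (Y : BField d 𝔸) : ‖permBF σ Y‖ ≤ ‖Y‖ :=
  lp.norm_le_of_forall_le (norm_nonneg _) fun b => lp.norm_apply_le_norm ENNReal.top_ne_zero Y (permSite σ b.1, σ b.2)

omit [NormedAlgebra ℂ 𝔸] [NormOneClass 𝔸] [CompleteSpace 𝔸] in
/-- `r_{στ} = r_τ ∘ r_σ` on `ℓ^∞` (pull-backs compose contravariantly). [cite: Balaban1987RG1, (2.17) p.269] -/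
theorem permBF_mul (σ τ : Equiv.Perm (Fin d)) (Y : BField d 𝔸) : permBF (σ * τ) Y = permBF τ (permBF σ Y) :=
  lp.ext (by rw [coe_permBF, coe_permBF, coe_permBF, permE_mul])

omit [NormedAlgebra ℂ 𝔸] [NormOneClass 𝔸] [CompleteSpace 𝔸] in
/-- `r_1 = 1` on `ℓ^∞`. [cite: Balaban1987RG1, (2.17) p.269] -/
theorem permBF_one (Y : BField d 𝔸) : permBF (1 : Equiv.Perm (Fin d)) Y = Y :=
  lp.ext (by rw [coe_permBF, permE_one])

omit [NormedAlgebra ℂ 𝔸] [NormOneClass 𝔸] [CompleteSpace 𝔸] in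
/-- `r_{σ⁻¹}(r_σY) = Y` on `ℓ^∞`. [cite: Balaban1987RG1, (2.17) p.269] -/
theorem permBF_inv_permBF (σ : Equiv.Perm (Fin d)) (Y : BField d 𝔸) : permBF σ⁻¹ (permBF σ Y) = Y := by
  rw [← permBF_mul, mul_inv_cancel, permBF_one]

omit [NormedAlgebra ℂ 𝔸] [NormOneClass 𝔸] [CompleteSpace 𝔸] in
/-- `r_σ(r_{σ⁻¹}Y) = Y` on `ℓ^∞`. [cite: Balaban1987RG1, (2.17) p.269] -/
theorem permBF_permBF_inv (σ : Equiv.Perm (Fin d)) (Y : BField d 𝔸) : permBF σ (permBF σ⁻¹ Y) = Y := by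
  rw [← permBF_mul, inv_mul_cancel, permBF_one]

omit [NormedAlgebra ℂ 𝔸] [NormOneClass 𝔸] [CompleteSpace 𝔸] in
/-- **`r_σ` IS AN ISOMETRY OF THE SUP NORM.** [cite: Balaban1987RG1, (2.17) p.269] -/
theorem norm_permBF (σ : Equiv.Perm (Fin d)) (Y : BField d 𝔸) : ‖permBF σ Y‖ = ‖Y‖ := by
  refine le_antisymm (norm_permBF_le σ Y) ?_
  have h := norm_permBF_le σ⁻¹ (permBF σ Y)
  rwa [permBF_inv_permBF] at h

omit [NormedAlgebra ℂ 𝔸] [NormOneClass 𝔸] [CompleteSpace 𝔸] in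
/-- `r_σ` is additive: `r_σ(Y − Z) = r_σY − r_σZ`. [cite: Balaban1987RG1, (2.17) p.269] -/
theorem permBF_sub (σ : Equiv.Perm (Fin d)) (Y Z : BField d 𝔸) : permBF σ (Y - Z) = permBF σ Y - permBF σ Z := by
  refine lp.ext (funext fun b => ?_)
  simp only [lp.coeFn_sub, coe_permBF, Pi.sub_apply, permE_apply]

omit [NormedAlgebra ℂ 𝔸] [NormOneClass 𝔸] [CompleteSpace 𝔸] in
/-- `r_σ 0 = 0`. [cite: Balaban1987RG1, (2.17) p.269] -/
theorem permBF_zero (σ : Equiv.Perm (Fin d)) : permBF σ (0 : BField d 𝔸) = 0 := by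
  refine lp.ext (funext fun b => ?_)
  simp only [coe_permBF, lp.coeFn_zero, permE_apply, Pi.zero_apply]

omit [NormOneClass 𝔸] [CompleteSpace 𝔸] in
/-- **`r_σ` AS A `ℂ`-LINEAR ISOMETRIC AUTOMORPHISM OF `ℓ^∞`** (print: (2.18) «generates an orthogonal transformation of
the fluctuation field B′» — here the sup-norm version for the relabelling `r_σ`), WITH BODY, inverse `r_{σ⁻¹}`.
[cite: Balaban1987RG1, (2.17) p.269] -/
def permBFEquiv (σ : Equiv.Perm (Fin d)) : BField d 𝔸 ≃ₗᵢ[ℂ] BField d 𝔸 where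
  toFun := permBF σ
  invFun := permBF σ⁻¹
  map_add' Y Z := lp.ext (funext fun b => by
    simp only [coe_permBF, lp.coeFn_add, Pi.add_apply, permE_apply])
  map_smul' a Y := lp.ext (funext fun b => by
    simp only [coe_permBF, lp.coeFn_smul, Pi.smul_apply, permE_apply, RingHom.id_apply])
  left_inv := permBF_inv_permBF σ
  right_inv := permBF_permBF_inv σ
  norm_map' := norm_permBF σ

omit [NormOneClass 𝔸] [CompleteSpace 𝔸] in
/-- Unfolding of `permBFEquiv`. [cite: Balaban1987RG1, (2.17) p.269] -/
@[simp] theorem permBFEquiv_apply (σ : Equiv.Perm (Fin d)) (Y : BField d 𝔸) :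
    (permBFEquiv σ : BField d 𝔸 ≃ₗᵢ[ℂ] BField d 𝔸) Y = permBF σ Y := rfl

variable (hL : 0 < L) (hd : 1 ≤ d) (σ : Equiv.Perm (Fin d)) (V : ZdEdge d → 𝔸ˣ) (hV : ∀ b, V b ∈ U1 𝔸)
  {ε₀ : ℝ} (hε₀ : 0 ≤ ε₀) (hsm : ((d : ℝ) * L) ^ 2 * ε₀ ≤ 1 / 200) (hsm4 : ((d : ℝ) * L) ^ 2 * ε₀ ≤ 1 / 400)
  (h44 : ∀ (p : Fin d → ℤ) (i j : Fin d), i ≠ j → ‖((plaquetteHolonomyZd V p i j : 𝔸ˣ) : 𝔸) - 1‖ ≤ ε₀)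
  (hbud : (L : ℝ) ^ d / L * (24 * omegaA d L ε₀) < 1)

include hsm4 in
/-- **`h` ON `ℓ^∞` IS COVARIANT UNDER (2.17)**: `h_{r_σV}(r_σX) = r_σ(h_V X)` for `B12LinearizationGenuineZd.hfield`
(`(dL)²ε₀ ≤ 1/400`, which gives the strict threshold of § 5). [cite: Balaban1987RG1, p.267]
[cite: Balaban1987RG1, (2.17) p.269] -/
theorem hfield_permE (X : BField d 𝔸) :
    hfield hL hd (permE σ V) (permE_mem_U1 σ hV) hε₀ hsm (permE_regular σ h44) hbud (permBF σ X)
      = permBF σ (hfield hL hd V hV hε₀ hsm h44 hbud X) := by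
  refine lp.ext ?_
  rw [hfield_apply, coe_permBF, coe_permBF, hfield_apply]
  unfold B12LinearizationGenuineZd.hc
  exact hOp_hAverage_permE hL hd σ V hV hε₀ (by linarith) h44 _ _ _ _ _ _ _ _ _ _ _ _

include hsm4 in
/-- **`C̃` ON `ℓ^∞` IS COVARIANT UNDER (2.17)**: `C̃_{r_σV}(r_σY) = r_σC̃_V(Y)` for `B12LinearizationGenuineZd.Cfield` (on
its ball `‖Y‖·dL ≤ 1/1200` by § 6, `(dL)²ε₀ ≤ 1/400`; off it both sides are the file's `0`-extension, `r_σ` being an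
isometry). [cite: Balaban1987RG1, p.267][cite: Balaban1987RG1, (2.17) p.269] -/
theorem Cfield_permE (Y : BField d 𝔸) :
    Cfield hL hd (permE σ V) (permE_mem_U1 σ hV) hε₀ hsm (permE_regular σ h44) (permBF σ Y)
      = permBF σ (Cfield hL hd V hV hε₀ hsm h44 Y) := by
  by_cases hY : ‖Y‖ * ((d : ℝ) * L) ≤ 1 / 1200
  · have hY' : ‖permBF σ Y‖ * ((d : ℝ) * L) ≤ 1 / 1200 := by rwa [norm_permBF]
    refine lp.ext (funext fun c => ?_)
    rw [Cfield_apply _ _ _ _ _ _ _ _ hY', coe_permBF, coe_permBF, permE_apply, Cfield_apply _ _ _ _ _ _ _ _ hY]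
    exact Ctilde_permE hL hd σ hV hε₀ hsm4 h44 (fun b => lp.norm_apply_le_norm ENNReal.top_ne_zero Y b) hY c
  · have hY' : ¬ ‖permBF σ Y‖ * ((d : ℝ) * L) ≤ 1 / 1200 := by rwa [norm_permBF]
    simp only [B12LinearizationGenuineZd.Cfield, dif_neg hY', dif_neg hY, permBF_zero]

include hsm4 in
/-- **THE FUNCTION `D̃` OF P. 267 IS COVARIANT UNDER (2.17)** («there exists exactly one solution of this equation»):
if `D̃_V` solves the fixed-point equation `C̃_V(B − hD̃_V(B)) = D̃_V(B)` in the ball of radius `r` for `‖B‖ < ε`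
(existence clause of `B12LinearizationGenuineZd.p267_genuine` at `V`) and `D̃_{r_σV}` is the unique such solution at
`r_σV` (its uniqueness clause there, same `ε`, `r`), then `D̃_{r_σV}(r_σB) = r_σD̃_V(B)` for `‖B‖ < ε` — by the
covariance of `h` and `C̃` the relabelled solution solves the relabelled equation. [cite: Balaban1987RG1, p.267]
[cite: Balaban1987RG1, (2.17) p.269] -/
theorem Dtilde_permE {ε r : ℝ} {DtV DtU : BField d 𝔸 → BField d 𝔸}
    (hDtV : ∀ B : BField d 𝔸, ‖B‖ < ε →
      DtV B ∈ Metric.closedBall (0 : BField d 𝔸) r ∧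
      Cfield hL hd V hV hε₀ hsm h44 (B - hfield hL hd V hV hε₀ hsm h44 hbud (DtV B)) = DtV B)
    (hDtU : ∀ B : BField d 𝔸, ‖B‖ < ε → ∀ X ∈ Metric.closedBall (0 : BField d 𝔸) r,
      Cfield hL hd (permE σ V) (permE_mem_U1 σ hV) hε₀ hsm (permE_regular σ h44)
          (B - hfield hL hd (permE σ V) (permE_mem_U1 σ hV) hε₀ hsm (permE_regular σ h44) hbud X) = X →
        X = DtU B)
    (B : BField d 𝔸) (hB : ‖B‖ < ε) :
    DtU (permBF σ B) = permBF σ (DtV B) := by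
  obtain ⟨hball, hfix⟩ := hDtV B hB
  symm
  refine hDtU (permBF σ B) (by rwa [norm_permBF]) _ ?_ ?_
  · rw [Metric.mem_closedBall, dist_zero_right, norm_permBF]
    rwa [Metric.mem_closedBall, dist_zero_right] at hball
  · rw [hfield_permE hL hd σ V hV hε₀ hsm hsm4 h44 hbud, ← permBF_sub,
      Cfield_permE hL hd σ V hV hε₀ hsm hsm4 h44, hfix]

end Field

end Literature.MathematicalPhysics.QuantumFieldTheory.Balaban1983to89.B12Def267Permutation

end
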